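import Literature.NumberTheory.Automorphic.RestrictedTensorProductCentralCoinvariants
import Literature.NumberTheory.GelbartRogawski1991.FiniteAdelicSplittingAssembly
import HarnessLib

-- buildfix G11b-3 recipe (LEDGER B13-1/B13-3): elaborate sequentially so the trailing `attribute [implicit_reducible]`
-- block (reducibilityCoreExt is keyed to the async environment branch) is in force at `.olean` export.
set_option Elab.async false

/-!
# [Liu2021, Def. 4.11]'s `⊗'` clause for the finite Weil representation of a unitary group assembled from local splittings

Topic `NumberTheory/GelbartRogawski1991`; namespace
`Literature.NumberTheory.GelbartRogawski1991.UnitaryDualPair.LocalSplitting.FinLocalSplittings` (dot-notation on the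
tree's `FinLocalSplittings` of `FiniteAdelicSplittingAssembly.lean`).  Theorems only (no definition, no record, no named
fact): the instantiation of `Literature.NumberTheory.Automorphic.finiteAdeleRep_centralCoinv`
(`RestrictedTensorProductCentralCoinvariants.lean`) at the place-assembled finite Weil representation
`𝓢.OmegaPi = ⊗'_v ω_v` (`ω_v = 𝓢.omegaLoc v = toRep ∘ s_v` on `𝒮(F_vᴺ)`) of a family `𝓢 : FinLocalSplittings` of LOCAL
splittings `s_v : U(J)(F_v) →* S̃p_{ψ_v}(𝕎_v)` ([GelbartRogawski1991, §3.1 Prop. 3.1.1 p. 455 lines 1–3] «at each place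
`v` … a homomorphism `s_v`»; Liu's `ι_{μ_v}`, [Liu2021, App. D §D.1 Step 1]), restricted along a CENTRAL family of local
homomorphisms `φ_v : H_v →* U(J)(F_v)` (e.g. the local centre `E_v¹`):

* `FinLocalSplittings.omegaPi_centralCoinv` — the coinvariants `Coinv(Ω ∘ Πʳφ, χ)`, `χ = ∏_v χ_v`, with the induced
  action of `Πʳ_v [U(J)(F_v), U(J)(𝒪_v)]`, ARE `⊗'_v Coinv(ω_v ∘ φ_v, χ_v)` w.r.t. the classes `[1_{𝒪_vᴺ}]`
  (tree predicate `IsRestrictedTensorProductRep`; exceptional set any finite `S₁` off which `[1_{𝒪_vᴺ}] ≠ 0`);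
* `FinLocalSplittings.omegaPi_centralCoinv_nontrivial` — hence `Coinv(Ω ∘ Πʳφ, χ) ≠ 0` from the non-vanishing of the
  local quotients at the places of `S₁`.

With `φ_v` the centre this is [Liu2021, Def. 4.11] (FJcycle.tex l. 2092–2096) «`ω(μ, ε, χ) := ⊗'_v ω(μ_v, ε_v, χ_v)`»,
`ω(μ_v, ε_v, χ_v) :=` «the maximal quotient of `ω(μ_v, ε_v) = ω(ε_v) ∘ ι_{μ_v}` on which the centre acts by `χ_v`»
(App. D §D.1 Step 3, l. 5218–5223), as a KERNEL CERTIFICATE on the tree's own Weil carrier: the global central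
`χ`-quotient of `⊗'_v ω(μ_v, ε_v)` IS the restricted tensor product of the local ones.  Displayed local input: the
survival of the unramified vector off `S₁` (Def. 4.11 «unramified for all but finitely many `v`»); the `Nontrivial`
corollary is the `hj`/non-vanishing input of `Liu2021.Thm418Data.nontrivial_omega_of_localOscillator`
(`Liu2021/AdelicOscillatorNonvanishing.lean`) once the local quotients are read through [Liu2021, App. D Lem. D.1 (1)]
(`Liu2021/LemD1AsPrinted.lean`).

NOT here: the local centre `E_v¹ ↪ U(J)(F_v)` as a named homomorphism (the statements are for any central family
`φ_v`; the tree's finite-adelic centre is `UnitaryGroup.finAdelicCenter`, `UnitaryGroupFinAdelicCenter.lean`), and the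
comparison with the Weil representation through an ABSTRACT compatible adelic splitting
(`UnitaryDualPair.WeilCoinv.finPairRepW`; a central-twist statement, `SplittingDatum.IsCompatible.exists_central_twist`).

## References
* [Liu2021] Y. Liu, *Fourier–Jacobi cycles and arithmetic relative trace formula*, Camb. J. Math. 9 (2021) =
  arXiv:2102.11518: Def. 4.11 (l. 2083–2097), App. D §D.1 Steps 1–3 (l. 5214–5223), Lem. D.1 (1) (l. 5226–5229).
* [GelbartRogawski1991] S. Gelbart, J. Rogawski, Invent. Math. 105 (1991), §3.1 Prop. 3.1.1 p. 455.
* [Flath1979] D. Flath, *Decomposition of representations into tensor products*, PSPM 33 (1979) part 1, §2, Example 2.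
* [MoeglinVignerasWaldspurger1987] C. Mœglin, M.-F. Vignéras, J.-L. Waldspurger, LNM 1291, Chap. 2 II.1, Chap. 3 IV.
-/

noncomputable section

open scoped RestrictedProduct
open Filter Function Set IsDedekindDomain NumberField
open Literature.RepresentationTheory

/-! ### §3b [Liu2021, Def. 4.11] for the finite Weil representation of a unitary group assembled from local splittings -/

namespace Literature.NumberTheory.GelbartRogawski1991.UnitaryDualPair.LocalSplitting.FinLocalSplittings

open scoped Classical
open Literature.NumberTheory.Automorphic

universe uH

variable {F : Type} [Field F] [NumberField F] {E : Type} [Field E] [NumberField E] [Algebra F E]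
  [Algebra.IsQuadraticExtension F E] {c : E ≃ₐ[F] E} {N : ℕ} {δ : E} {hcδ : c δ = -δ} {hδ : δ ≠ 0} {d : F}
  {hd : δ * δ = algebraMap F E d} {T : Matrix (Fin N) (Fin N) F} {hT : T.IsSymm}
  {J : Matrix (Fin N) (Fin N) E} {hJ : J = T.map (algebraMap F E)}
  (𝓢 : FinLocalSplittings F E c N hcδ hδ hd T hT hJ)
  {H : HeightOneSpectrum (𝓞 F) → Type uH} [∀ v, Group (H v)] {KH : ∀ v, Subgroup (H v)}
  (φ : ∀ v, H v →* UnitaryGroup.localPi E c N J v)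
  (hφ : ∀ᶠ v in cofinite, MapsTo (φ v) (KH v) (UnitaryGroup.localInt E c N J v))
  {χloc : ∀ v, H v →* ℂˣ}
  {hq : ∀ᶠ v in cofinite,
    TwistedCoinv.mk (show Representation ℂ (H v) _ from (𝓢.omegaLoc v).comp (φ v)) (χloc v) (unitVec F (Fin N) v) =
      TwistedCoinv.mk (show Representation ℂ (H v) _ from (𝓢.omegaLoc v).comp (φ v)) (χloc v) (unitVec F (Fin N) v)}

/-- **[Liu2021, Def. 4.11]'s `⊗'` clause on the tree's Weil carrier.**  For a family of local splittings `𝓢`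
(`FinLocalSplittings`: `s_v : U(J)(F_v) →* S̃p_{ψ_v}(𝕎_v)` over `ι_v`, smooth, unramified almost everywhere — Liu's
`ι_{μ_v}`), its local Weil representations `ω_v = 𝓢.omegaLoc v` on `𝒮(F_vᴺ)` and their place-assembled restricted tensor
product `Ω = 𝓢.OmegaPi = ⊗'_v ω_v` on `𝒮((𝔸_F^∞)ᴺ)`, a family `φ_v : H_v →* U(J)(F_v)` (`φ_v(KH_v) ⊆ U(J)(𝒪_v)` almost
everywhere) whose Weil operators commute with the `ω_v(g)` (`hc`, `hcomm` — automatic for `φ_v` of CENTRAL image, e.g. the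
local centre `E_v¹`, by `map_mul`), local characters `χ_v` (trivial on `KH_v` almost everywhere) and `χ = ∏_v χ_v`: the
coinvariants `Coinv(Ω ∘ Πʳφ, χ)` — «the maximal quotient on which `Πʳ_v H_v` acts by `χ`» — with the induced action
`TwistedCoinv.rep χ Ω hcomm` of `Πʳ_v [U(J)(F_v), U(J)(𝒪_v)]`, together with any comparison map `Jc`
(`IsRestrictedTensorProductRep.exists_centralCoinvMap`), ARE the restricted tensor product `⊗'_v Coinv(ω_v ∘ φ_v, χ_v)` of
the local maximal `χ_v`-quotients w.r.t. the classes `[1_{𝒪_vᴺ}]`, with exceptional set any finite `S₁` off which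
`[1_{𝒪_vᴺ}] ≠ 0` (`hx₀'` is supplied by `IsRestrictedTensorProductRep.eventually_mk_mem_fixedPoints hc
𝓢.unitVec_mem_fixedPoints`).  With `φ_v` the centre: `ω(μ, ε, χ) := ⊗'_v ω(μ_v, ε_v, χ_v)` (Def. 4.11, l. 2092–2096) for
`ω(μ_v, ε_v, χ_v) :=` the maximal quotient of `ω(μ_v, ε_v) = ω(ε_v) ∘ ι_{μ_v}` with central character `χ_v`
(App. D §D.1 Step 3) IS the global central `χ`-quotient of `⊗'_v ω(μ_v, ε_v)`.
[cite: Liu2021, Def. 4.11 (l. 2092–2096), App. D §D.1 Steps 1–3 (l. 5214–5223); Flath1979, §2  Example 2] -/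
theorem omegaPi_centralCoinv
    (hc : ∀ (v : HeightOneSpectrum (𝓞 F)) (g : UnitaryGroup.localPi E c N J v) (h' : H v),
      Commute (𝓢.omegaLoc v g) ((show Representation ℂ (H v) _ from (𝓢.omegaLoc v).comp (φ v)) h'))
    (hcomm : ∀ (g : Πʳ v : HeightOneSpectrum (𝓞 F), [UnitaryGroup.localPi E c N J v, UnitaryGroup.localInt E c N J v])
        (h' : Πʳ v, [H v, KH v]),
      Commute (𝓢.OmegaPi g)
        ((𝓢.OmegaPi.comp (RestrictedProduct.mapAlongMonoidHom H (fun v => UnitaryGroup.localPi E c N J v) id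
          Filter.tendsto_id φ hφ)) h'))
    (χ : (Πʳ v, [H v, KH v]) →* ℂˣ)
    (hχ : ∀ g : Πʳ v, [H v, KH v], ((χ g : ℂˣ) : ℂ) = ∏ᶠ v, ((χloc v (g v) : ℂˣ) : ℂ))
    (hχK : ∀ᶠ v in cofinite, ∀ g ∈ KH v, χloc v g = 1)
    {S₁ : Finset (HeightOneSpectrum (𝓞 F))}
    (hx₀N : ∀ v ∉ S₁,
      TwistedCoinv.mk (show Representation ℂ (H v) _ from (𝓢.omegaLoc v).comp (φ v)) (χloc v) (unitVec F (Fin N) v)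
        ≠ 0)
    (hx₀' : ∀ᶠ v in cofinite,
      TwistedCoinv.mk (show Representation ℂ (H v) _ from (𝓢.omegaLoc v).comp (φ v)) (χloc v) (unitVec F (Fin N) v) ∈
        (TwistedCoinv.rep (χloc v) (𝓢.omegaLoc v) (hc v)).fixedPoints (UnitaryGroup.localInt E c N J v))
    (Jc : RestrictedFamily
        (fun v => TwistedCoinv.Coinv (show Representation ℂ (H v) _ from (𝓢.omegaLoc v).comp (φ v)) (χloc v))
        (fun v => TwistedCoinv.mk (show Representation ℂ (H v) _ from (𝓢.omegaLoc v).comp (φ v)) (χloc v)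
          (unitVec F (Fin N) v)) →
      TwistedCoinv.Coinv
        (𝓢.OmegaPi.comp (RestrictedProduct.mapAlongMonoidHom H (fun v => UnitaryGroup.localPi E c N J v) id
          Filter.tendsto_id φ hφ)) χ)
    (hJc : ∀ x : LocalSBFamily F (Fin N),
      Jc (RestrictedFamily.piMap
          (x₀' := fun v =>
            TwistedCoinv.mk (show Representation ℂ (H v) _ from (𝓢.omegaLoc v).comp (φ v)) (χloc v)
              (unitVec F (Fin N) v))
          (fun v => TwistedCoinv.mk (show Representation ℂ (H v) _ from (𝓢.omegaLoc v).comp (φ v)) (χloc v)) hq x) =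
        TwistedCoinv.mk
          (𝓢.OmegaPi.comp (RestrictedProduct.mapAlongMonoidHom H (fun v => UnitaryGroup.localPi E c N J v) id
            Filter.tendsto_id φ hφ)) χ (piProdSB F (Fin N) x)) :
    IsRestrictedTensorProductRep (fun v => TwistedCoinv.rep (χloc v) (𝓢.omegaLoc v) (hc v))
      (TwistedCoinv.rep χ 𝓢.OmegaPi hcomm) hx₀' Jc S₁ :=
  finiteAdeleRep_centralCoinv F (Fin N) 𝓢.omegaLoc 𝓢.unitVec_mem_fixedPoints φ hφ hc hcomm χ hχ hχK hx₀N hx₀' Jc hJc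

/-- **`ω(μ, ε, χ) ≠ 0` from the local quotients** ([Liu2021, Def. 4.11] with App. D Lem. D.1 (1) at the places of
`S₁`; off `S₁` the survival of the unramified vector is the input `hx₀N`): `Coinv(Ω ∘ Πʳφ, χ) ≠ 0` as soon as the local
maximal `χ_v`-quotients at the places of `S₁` are non-zero. [cite: Liu2021, Def. 4.11 (l. 2092–2096),
App. D Lem. D.1 (1) (l. 5226–5229); Flath1979, §2] -/
theorem omegaPi_centralCoinv_nontrivial (χ : (Πʳ v, [H v, KH v]) →* ℂˣ)
    (hχ : ∀ g : Πʳ v, [H v, KH v], ((χ g : ℂˣ) : ℂ) = ∏ᶠ v, ((χloc v (g v) : ℂˣ) : ℂ))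
    (hχK : ∀ᶠ v in cofinite, ∀ g ∈ KH v, χloc v g = 1)
    {S₁ : Finset (HeightOneSpectrum (𝓞 F))}
    (hx₀N : ∀ v ∉ S₁,
      TwistedCoinv.mk (show Representation ℂ (H v) _ from (𝓢.omegaLoc v).comp (φ v)) (χloc v) (unitVec F (Fin N) v)
        ≠ 0)
    (hS₁ : ∀ v ∈ S₁,
      Nontrivial (TwistedCoinv.Coinv (show Representation ℂ (H v) _ from (𝓢.omegaLoc v).comp (φ v)) (χloc v)))
    (Jc : RestrictedFamily
        (fun v => TwistedCoinv.Coinv (show Representation ℂ (H v) _ from (𝓢.omegaLoc v).comp (φ v)) (χloc v))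
        (fun v => TwistedCoinv.mk (show Representation ℂ (H v) _ from (𝓢.omegaLoc v).comp (φ v)) (χloc v)
          (unitVec F (Fin N) v)) →
      TwistedCoinv.Coinv
        (𝓢.OmegaPi.comp (RestrictedProduct.mapAlongMonoidHom H (fun v => UnitaryGroup.localPi E c N J v) id
          Filter.tendsto_id φ hφ)) χ)
    (hJc : ∀ x : LocalSBFamily F (Fin N),
      Jc (RestrictedFamily.piMap
          (x₀' := fun v =>
            TwistedCoinv.mk (show Representation ℂ (H v) _ from (𝓢.omegaLoc v).comp (φ v)) (χloc v)
              (unitVec F (Fin N) v))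
          (fun v => TwistedCoinv.mk (show Representation ℂ (H v) _ from (𝓢.omegaLoc v).comp (φ v)) (χloc v)) hq x) =
        TwistedCoinv.mk
          (𝓢.OmegaPi.comp (RestrictedProduct.mapAlongMonoidHom H (fun v => UnitaryGroup.localPi E c N J v) id
            Filter.tendsto_id φ hφ)) χ (piProdSB F (Fin N) x)) :
    Nontrivial (TwistedCoinv.Coinv
      (𝓢.OmegaPi.comp (RestrictedProduct.mapAlongMonoidHom H (fun v => UnitaryGroup.localPi E c N J v) id
        Filter.tendsto_id φ hφ)) χ) :=
  finiteAdeleRep_centralCoinv_nontrivial F (Fin N) 𝓢.omegaLoc 𝓢.unitVec_mem_fixedPoints φ hφ χ hχ hχK hx₀N hS₁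
    Jc hJc

/-! ### Build-lane note (ops-buildfix G11b-3 recipe, LEDGER B13-1, 2026-08-21)
`lean -o` (the hub build lane, never `lean`/the gate check) runs Lean 4.32's library-suggestion indexers
(`Lean.LibrarySuggestions.SymbolFrequency` / `SineQuaNon`, from their `exportEntriesFn`) over the statement of
every local theorem that is not a denied premise; on this family's statements (very large dependent binder
telescopes through the theta-kernel / dual-pair data) that fold runs for tens of minutes to hours and the build
lane kills the job (incident G11b-3, run/shared/lean/ops/buildfix/G11b-3-DOSSIER.md). `isDeniedPremise` skips
`[implicit_reducible]` constants before any fold, and a reducibility status on a *theorem* is inert (Meta never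
unfolds `thmInfo`; the kernel ignores the attribute), so the public theorems of this file are tagged
`[implicit_reducible]` purely to keep them out of that index. Only other effect: they are not offered by
`+suggestions` premise selectors. No statement or proof is changed; superseded if the operator lands a
deny-list form (`HarnessLib.PremiseIndex`). -/
set_option allowUnsafeReducibility true in
attribute [implicit_reducible]
  omegaPi_centralCoinv omegaPi_centralCoinv_nontrivial

end Literature.NumberTheory.GelbartRogawski1991.UnitaryDualPair.LocalSplitting.FinLocalSplittings

end
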